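import Mathlib
import HarnessLib
import Literature.Computability.Complexity.CNF
import Literature.Computability.Complexity.PNPWave0

/-!
# PneNP / OverlapGapAlgebra — `SearchHardWindow`: the unread-or-forgotten polarity rung

Support for crux `stmt-PneNP-2460` (`Summit.PneNP.PneNP.Theses.OverlapGapAlgebra.SearchHardWindow`).
Common generalisation of the query rung (`…SearchHardWindowQueryRung`: adaptive clause-probing
solvers leaving `s` clauses unread), the sign-oblivious rung (`…SearchHardWindowSignRung`) and
the polarity rung (`…SearchHardWindowPolarityRung`: outputs
taking `≤ N` values per variable pattern), for the crux's hardness conjunct, UNCONDITIONALLY for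
every `k` and `α`. A solver `A` on instances `Φ : Fin m → Fin k → Fin n × Bool` is given the whole
VARIABLE pattern for free; `U Φ` is a set of clause positions whose POLARITIES are unread,
self-consistently (`U` does not change when the signs at the positions in `U Φ` change, the
variable pattern being kept), and on each such sign cylinder the output `A` takes at most `N` values
(`N = 1`: the output ignores the unread polarities — the leaf of an adaptive polarity-probing
decision tree that may consult every variable index; general `N = 2^b`: it moreover forgets all but
`b` bits of what it read). Then (`shwU_card_solved_le`)
`#{Φ : A Φ ⊨ Φ} ≤ N · (1 - 2^{-k})^s · #instances` whenever `|U Φ| ≥ s`: inside a sign cylinder the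
instances satisfied by a FIXED `σ` at the free positions form a box of density exactly
`(1 - 2^{-k})^{|U Φ|}` (`shwU_card_cyl_satBy`). `U ≡ ∅ᶜ` is the polarity rung, `N = 1` with `U`
stable under arbitrary changes is the query rung. Asymptotic form `shwU_ratio_eventually_le`
(`N n (1 - 2^{-k})^{s n} → 0`) and the verbatim-conjunct corollary
`shwU_hardnessConjunct_of_unreadPolarities` for `f : List Bool → List Bool`.
No new definitions; axioms `propext`, `Classical.choice`, `Quot.sound`.
-/

set_option linter.dupNamespace false -- `Summit.PneNP.PneNP.…`: summit = sub-problem (D-0017)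

namespace Summit.PneNP.PneNP.Theorems

open Finset Filter
open scoped Classical

section Count

variable {m k n : ℕ}

/-- Attaching a fixed variable pattern to sign vectors is injective. -/
theorem shwU_signs_injective (Vc : Fin k → Fin n) :
    Function.Injective fun (s : Fin k → Bool) (j : Fin k) => (Vc j, s j) := by
  intro s s' h
  funext j
  simpa using congr_fun h j

/-- Clause boxes over a prescribed variable pattern: `2^k` clauses, `2^k - 1` of them satisfied by a
fixed `σ` (the failing sign vector is `j ↦ ¬σ (w j)`). These are `shwS_card_skeletonBox` /
`shwS_card_skeletonBox_sat` of `…SearchHardWindowSignRung` (not importable when this file landed: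
the farm had not built that module), packaged as one conjunction. [folklore] -/
theorem shwU_card_clauseBoxes (w : Fin k → Fin n) (σ : Fin n → Bool) :
    ((univ : Finset (Fin k → Fin n × Bool)).filter fun c => ∀ j, (c j).1 = w j).card = 2 ^ k ∧
    ((univ : Finset (Fin k → Fin n × Bool)).filter fun c =>
        (∀ j, (c j).1 = w j) ∧ ∃ j, σ (c j).1 = (c j).2).card = 2 ^ k - 1 := by
  have hall : ((univ : Finset (Fin k → Fin n × Bool)).filter fun c => ∀ j, (c j).1 = w j)
      = (univ : Finset (Fin k → Bool)).image fun s j => (w j, s j) := by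
    ext c
    simp only [mem_filter, mem_univ, true_and, mem_image]
    constructor
    · intro hc
      exact ⟨fun j => (c j).2, funext fun j => Prod.ext (hc j).symm rfl⟩
    · rintro ⟨s, rfl⟩ j
      rfl
  have hsat : ((univ : Finset (Fin k → Fin n × Bool)).filter fun c =>
        (∀ j, (c j).1 = w j) ∧ ∃ j, σ (c j).1 = (c j).2)
      = ((univ : Finset (Fin k → Bool)).filter fun s => ∃ j, σ (w j) = s j).image
          fun s j => (w j, s j) := by
    ext c
    simp only [mem_filter, mem_univ, true_and, mem_image]
    constructor
    · rintro ⟨hc, j, hj⟩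
      refine ⟨fun j => (c j).2, ⟨j, ?_⟩, funext fun j => Prod.ext (hc j).symm rfl⟩
      rwa [← hc j]
    · rintro ⟨s, ⟨j, hj⟩, rfl⟩
      exact ⟨fun _ => rfl, j, hj⟩
  have hneg : ((univ : Finset (Fin k → Bool)).filter fun s => ¬ ∃ j, σ (w j) = s j)
      = {fun j => !σ (w j)} := by
    ext s
    simp only [mem_filter, mem_univ, true_and, mem_singleton, not_exists]
    constructor
    · intro hs
      funext j
      have := hs j
      cases hσ : σ (w j) <;> cases hsj : s j <;> simp_all
    · rintro rfl j
      show σ (w j) ≠ !σ (w j)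
      cases σ (w j) <;> decide
  have hsplit := card_filter_add_card_filter_not (s := (univ : Finset (Fin k → Bool)))
    (fun s => ∃ j, σ (w j) = s j)
  rw [hneg, card_singleton, card_univ, Fintype.card_fun, Fintype.card_fin, Fintype.card_bool]
    at hsplit
  rw [hall, hsat, card_image_of_injective _ (shwU_signs_injective w),
    card_image_of_injective _ (shwU_signs_injective w), card_univ, Fintype.card_fun,
    Fintype.card_fin, Fintype.card_bool]
  omega

/-- The sign cylinder through `Φ` with free positions `T` — same variable pattern, same clauses
off `T` — is a box. -/
theorem shwU_cyl_eq_piFinset (T : Finset (Fin m)) (Φ : Fin m → Fin k → Fin n × Bool) :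
    ((univ : Finset (Fin m → Fin k → Fin n × Bool)).filter fun Ψ =>
        (∀ i j, (Ψ i j).1 = (Φ i j).1) ∧ ∀ i ∉ T, Ψ i = Φ i)
      = Fintype.piFinset fun i => if i ∈ T then
          (univ : Finset (Fin k → Fin n × Bool)).filter fun c => ∀ j, (c j).1 = (Φ i j).1
        else {Φ i} := by
  ext Ψ
  simp only [mem_filter, mem_univ, true_and, Fintype.mem_piFinset]
  constructor
  · rintro ⟨hv, hoff⟩ i
    split_ifs with hi
    · exact mem_filter.2 ⟨mem_univ _, hv i⟩
    · exact mem_singleton.2 (hoff i hi)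
  · intro h
    refine ⟨fun i j => ?_, fun i hi => ?_⟩
    · by_cases hi : i ∈ T
      · have := h i
        rw [if_pos hi] at this
        exact (mem_filter.1 this).2 j
      · have := h i
        rw [if_neg hi] at this
        rw [mem_singleton.1 this]
    · have := h i
      rw [if_neg hi] at this
      exact mem_singleton.1 this

/-- A sign cylinder with `|T|` free positions has `(2^k)^{|T|}` points. -/
theorem shwU_card_cyl (T : Finset (Fin m)) (Φ : Fin m → Fin k → Fin n × Bool) :
    ((univ : Finset (Fin m → Fin k → Fin n × Bool)).filter fun Ψ =>
        (∀ i j, (Ψ i j).1 = (Φ i j).1) ∧ ∀ i ∉ T, Ψ i = Φ i).card = (2 ^ k) ^ T.card := by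
  rw [shwU_cyl_eq_piFinset, Fintype.card_piFinset]
  have h : ∀ i : Fin m, (if i ∈ T then
        (univ : Finset (Fin k → Fin n × Bool)).filter (fun c => ∀ j, (c j).1 = (Φ i j).1)
      else {Φ i}).card = if i ∈ T then 2 ^ k else 1 := by
    intro i
    split_ifs
    · exact (shwU_card_clauseBoxes _ fun _ => false).1
    · rfl
  simp_rw [h]
  rw [Finset.prod_ite_mem, univ_inter, prod_const]

/-- Inside a sign cylinder, the instances whose free clauses are all satisfied by a FIXED `σ` form a
box with `(2^k - 1)^{|T|}` points: density exactly `(1 - 2^{-k})^{|T|}`. -/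
theorem shwU_card_cyl_satBy (T : Finset (Fin m)) (Φ : Fin m → Fin k → Fin n × Bool)
    (σ : Fin n → Bool) :
    ((univ : Finset (Fin m → Fin k → Fin n × Bool)).filter fun Ψ =>
        ((∀ i j, (Ψ i j).1 = (Φ i j).1) ∧ ∀ i ∉ T, Ψ i = Φ i) ∧
          ∀ i ∈ T, ∃ j, σ (Ψ i j).1 = (Ψ i j).2).card = (2 ^ k - 1) ^ T.card := by
  have hbox : ((univ : Finset (Fin m → Fin k → Fin n × Bool)).filter fun Ψ =>
        ((∀ i j, (Ψ i j).1 = (Φ i j).1) ∧ ∀ i ∉ T, Ψ i = Φ i) ∧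
          ∀ i ∈ T, ∃ j, σ (Ψ i j).1 = (Ψ i j).2)
      = Fintype.piFinset fun i => if i ∈ T then
          (univ : Finset (Fin k → Fin n × Bool)).filter fun c =>
            (∀ j, (c j).1 = (Φ i j).1) ∧ ∃ j, σ (c j).1 = (c j).2
        else {Φ i} := by
    ext Ψ
    simp only [mem_filter, mem_univ, true_and, Fintype.mem_piFinset]
    constructor
    · rintro ⟨⟨hv, hoff⟩, hsat⟩ i
      split_ifs with hi
      · exact mem_filter.2 ⟨mem_univ _, hv i, hsat i hi⟩
      · exact mem_singleton.2 (hoff i hi)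
    · intro h
      refine ⟨⟨fun i j => ?_, fun i hi => ?_⟩, fun i hi => ?_⟩
      · by_cases hi : i ∈ T
        · have := h i
          rw [if_pos hi] at this
          exact (mem_filter.1 this).2.1 j
        · have := h i
          rw [if_neg hi] at this
          rw [mem_singleton.1 this]
      · have := h i
        rw [if_neg hi] at this
        exact mem_singleton.1 this
      · have := h i
        rw [if_pos hi] at this
        exact (mem_filter.1 this).2.2
  rw [hbox, Fintype.card_piFinset]
  have h : ∀ i : Fin m, (if i ∈ T then
        (univ : Finset (Fin k → Fin n × Bool)).filter (fun c =>
          (∀ j, (c j).1 = (Φ i j).1) ∧ ∃ j, σ (c j).1 = (c j).2)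
      else {Φ i}).card = if i ∈ T then 2 ^ k - 1 else 1 := by
    intro i
    split_ifs
    · exact (shwU_card_clauseBoxes _ σ).2
    · rfl
  simp_rw [h]
  rw [Finset.prod_ite_mem, univ_inter, prod_const]

end Count

section Adaptive

variable {m k n : ℕ}

/-- **The unread-or-forgotten polarity rung, counting form.** Let `A` map instances to assignments
and let `U Φ` be a set of clause positions whose polarities are unread, self-consistently: changing
the signs of `Φ` at positions in `U Φ` (keeping the variable pattern) does not change `U Φ`. If on
every such sign cylinder the output `A` takes at most `N` values and always `|U Φ| ≥ s`, then `A`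
solves at most `N · (1 - 2^{-k})^s · #instances` instances. (The variable pattern is free
information; `N = 1` = the output ignores the unread polarities; `U Φ = univ` = the polarity rung.) -/
theorem shwU_card_solved_le
    (A : (Fin m → Fin k → Fin n × Bool) → (Fin n → Bool))
    (U : (Fin m → Fin k → Fin n × Bool) → Finset (Fin m)) (s N : ℕ)
    (hU : ∀ Φ Ψ : Fin m → Fin k → Fin n × Bool,
      (∀ i j, (Ψ i j).1 = (Φ i j).1) → (∀ i ∉ U Φ, Ψ i = Φ i) → U Ψ = U Φ)
    (hN : ∀ Φ : Fin m → Fin k → Fin n × Bool,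
      (((univ : Finset (Fin m → Fin k → Fin n × Bool)).filter fun Ψ =>
          (∀ i j, (Ψ i j).1 = (Φ i j).1) ∧ ∀ i ∉ U Φ, Ψ i = Φ i).image A).card ≤ N)
    (hs : ∀ Φ, s ≤ (U Φ).card) :
    (((univ : Finset (Fin m → Fin k → Fin n × Bool)).filter fun Φ =>
        ∀ i, ∃ j, A Φ (Φ i j).1 = (Φ i j).2).card : ℝ)
      ≤ N * (1 - (1 / 2 : ℝ) ^ k) ^ s * Fintype.card (Fin m → Fin k → Fin n × Bool) := by
  -- the sign cylinder through `Φ`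
  set cyl : (Fin m → Fin k → Fin n × Bool) → Finset (Fin m → Fin k → Fin n × Bool) :=
    fun Φ => univ.filter fun Ψ => (∀ i j, (Ψ i j).1 = (Φ i j).1) ∧ ∀ i ∉ U Φ, Ψ i = Φ i
    with hcyl
  have mem_cyl : ∀ Φ Ψ, Ψ ∈ cyl Φ ↔ (∀ i j, (Ψ i j).1 = (Φ i j).1) ∧ ∀ i ∉ U Φ, Ψ i = Φ i :=
    fun Φ Ψ => by simp [hcyl]
  have self_mem : ∀ Φ, Φ ∈ cyl Φ := fun Φ => (mem_cyl Φ Φ).2 ⟨fun _ _ => rfl, fun _ _ => rfl⟩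
  -- cylinders are the fibres of `cyl`
  have cyl_eq_of_mem : ∀ Φ Ψ, Ψ ∈ cyl Φ → cyl Ψ = cyl Φ := by
    intro Φ Ψ hΨ
    rw [mem_cyl] at hΨ
    have hUeq : U Ψ = U Φ := hU Φ Ψ hΨ.1 hΨ.2
    ext Θ
    rw [mem_cyl, mem_cyl, hUeq]
    constructor
    · rintro ⟨hv, hoff⟩
      exact ⟨fun i j => (hv i j).trans (hΨ.1 i j), fun i hi => (hoff i hi).trans (hΨ.2 i hi)⟩
    · rintro ⟨hv, hoff⟩
      exact ⟨fun i j => (hv i j).trans (hΨ.1 i j).symm,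
        fun i hi => (hoff i hi).trans (hΨ.2 i hi).symm⟩
  have fiber_eq : ∀ Φ, (univ.filter fun Ψ => cyl Ψ = cyl Φ) = cyl Φ := by
    intro Φ
    ext Ψ
    simp only [mem_filter, mem_univ, true_and]
    exact ⟨fun h => h ▸ self_mem Ψ, cyl_eq_of_mem Φ Ψ⟩
  -- sizes
  have card_cyl : ∀ Φ, (cyl Φ).card = (2 ^ k) ^ (U Φ).card := fun Φ => shwU_card_cyl (U Φ) Φ
  have hq : ((2 ^ k - 1 : ℕ) : ℝ) = (1 - (1 / 2 : ℝ) ^ k) * 2 ^ k := by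
    rw [Nat.cast_sub Nat.one_le_two_pow, Nat.cast_pow, Nat.cast_two, Nat.cast_one, sub_mul,
      one_mul, one_div, inv_pow, inv_mul_cancel₀ (by positivity : (2 : ℝ) ^ k ≠ 0)]
  have hr0 : (0 : ℝ) ≤ 1 - (1 / 2 : ℝ) ^ k :=
    sub_nonneg.2 (pow_le_one₀ (by norm_num) (by norm_num))
  have hr1 : 1 - (1 / 2 : ℝ) ^ k ≤ 1 := sub_le_self _ (by positivity)
  -- per-cylinder bound
  set G : Finset (Fin m → Fin k → Fin n × Bool) :=
    univ.filter fun Φ => ∀ i, ∃ j, A Φ (Φ i j).1 = (Φ i j).2 with hG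
  have per_cyl : ∀ Φ, ((G.filter fun Ψ => cyl Ψ = cyl Φ).card : ℝ)
      ≤ N * (1 - (1 / 2 : ℝ) ^ k) ^ s * (cyl Φ).card := by
    intro Φ
    have hsub : (G.filter fun Ψ => cyl Ψ = cyl Φ) ⊆ ((cyl Φ).image A).biUnion fun σ =>
        univ.filter fun Ψ => ((∀ i j, (Ψ i j).1 = (Φ i j).1) ∧ ∀ i ∉ U Φ, Ψ i = Φ i) ∧
          ∀ i ∈ U Φ, ∃ j, σ (Ψ i j).1 = (Ψ i j).2 := by
      intro Ψ hΨ
      rw [mem_filter] at hΨ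
      obtain ⟨hΨG, hΨc⟩ := hΨ
      have hmem : Ψ ∈ cyl Φ := hΨc ▸ self_mem Ψ
      rw [hG, mem_filter] at hΨG
      refine mem_biUnion.2 ⟨A Ψ, mem_image_of_mem A hmem, mem_filter.2 ⟨mem_univ _, ?_, ?_⟩⟩
      · exact (mem_cyl Φ Ψ).1 hmem
      · exact fun i _ => hΨG.2 i
    have h1 : ((G.filter fun Ψ => cyl Ψ = cyl Φ).card : ℝ) ≤ N * ((2 ^ k - 1 : ℕ) : ℝ) ^ (U Φ).card := by
      have h2 : (G.filter fun Ψ => cyl Ψ = cyl Φ).card ≤ N * (2 ^ k - 1) ^ (U Φ).card :=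
        calc _ ≤ _ := card_le_card hsub
          _ ≤ ∑ σ ∈ (cyl Φ).image A, ((univ.filter fun Ψ : Fin m → Fin k → Fin n × Bool =>
                ((∀ i j, (Ψ i j).1 = (Φ i j).1) ∧ ∀ i ∉ U Φ, Ψ i = Φ i) ∧
                  ∀ i ∈ U Φ, ∃ j, σ (Ψ i j).1 = (Ψ i j).2).card) := card_biUnion_le
          _ = ((cyl Φ).image A).card * (2 ^ k - 1) ^ (U Φ).card := by
              simp only [shwU_card_cyl_satBy, sum_const, smul_eq_mul]
          _ ≤ N * (2 ^ k - 1) ^ (U Φ).card := Nat.mul_le_mul_right _ (hN Φ)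
      exact_mod_cast h2
    have hcast : ((cyl Φ).card : ℝ) = ((2 : ℝ) ^ k) ^ (U Φ).card := by
      rw [card_cyl Φ]; push_cast; ring
    rw [hcast]
    calc ((G.filter fun Ψ => cyl Ψ = cyl Φ).card : ℝ)
          ≤ N * ((2 ^ k - 1 : ℕ) : ℝ) ^ (U Φ).card := h1
      _ = N * (1 - (1 / 2 : ℝ) ^ k) ^ (U Φ).card * ((2 : ℝ) ^ k) ^ (U Φ).card := by
          rw [hq, mul_pow]; ring
      _ ≤ N * (1 - (1 / 2 : ℝ) ^ k) ^ s * ((2 : ℝ) ^ k) ^ (U Φ).card := by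
          refine mul_le_mul_of_nonneg_right (mul_le_mul_of_nonneg_left
            (pow_le_pow_of_le_one hr0 hr1 (hs Φ)) (Nat.cast_nonneg _)) (by positivity)
  -- sum over the fibres
  have hGsum := Finset.card_eq_sum_card_image cyl G
  have hUsum := Finset.card_eq_sum_card_image cyl (univ : Finset (Fin m → Fin k → Fin n × Bool))
  have himage : G.image cyl ⊆ univ.image cyl := image_subset_image (subset_univ _)
  calc ((G.card : ℕ) : ℝ) = ∑ D ∈ G.image cyl, ((G.filter fun Ψ => cyl Ψ = D).card : ℝ) := by
        rw [hGsum]; push_cast; rfl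
    _ ≤ ∑ D ∈ univ.image cyl, ((G.filter fun Ψ => cyl Ψ = D).card : ℝ) :=
        sum_le_sum_of_subset_of_nonneg himage fun _ _ _ => by positivity
    _ ≤ ∑ D ∈ univ.image cyl, N * (1 - (1 / 2 : ℝ) ^ k) ^ s *
          ((univ.filter fun Ψ : Fin m → Fin k → Fin n × Bool => cyl Ψ = D).card : ℝ) := by
        refine sum_le_sum fun D hD => ?_
        obtain ⟨Φ, -, rfl⟩ := mem_image.1 hD
        rw [fiber_eq Φ]
        exact per_cyl Φ
    _ = N * (1 - (1 / 2 : ℝ) ^ k) ^ s * Fintype.card (Fin m → Fin k → Fin n × Bool) := by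
        rw [← mul_sum, ← card_univ, hUsum]; push_cast; rfl

end Adaptive

section Asymptotic

open Literature.Computability.Complexity

/-- **Unread-or-forgotten polarity rung, asymptotic form (abstract solvers, any `k`, any `α`).**
A family of solvers `A n m` admitting self-consistent unread-polarity sets `U` with `|U Φ| ≥ s n`
on whose sign cylinders the output takes `≤ N n` values, where `N n · (1 - 2^{-k})^{s n} → 0`,
solves `F_k(n, ⌊αn⌋)` with probability `→ 0`. -/
theorem shwU_ratio_eventually_le (k : ℕ) (α : ℝ) (s N : ℕ → ℕ)
    (hN : Tendsto (fun n : ℕ => (N n : ℝ) * (1 - (1 / 2 : ℝ) ^ k) ^ s n) atTop (nhds 0))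
    (A : (n m : ℕ) → (Fin m → Fin k → Fin n × Bool) → (Fin n → Bool))
    (hA : ∀ᶠ n : ℕ in atTop, ∀ m : ℕ, m = ⌊α * n⌋₊ →
      ∃ U : (Fin m → Fin k → Fin n × Bool) → Finset (Fin m),
        (∀ Φ, s n ≤ (U Φ).card) ∧
        (∀ Φ Ψ : Fin m → Fin k → Fin n × Bool,
          (∀ i j, (Ψ i j).1 = (Φ i j).1) → (∀ i ∉ U Φ, Ψ i = Φ i) → U Ψ = U Φ) ∧
        ∀ Φ : Fin m → Fin k → Fin n × Bool,
          (((univ : Finset (Fin m → Fin k → Fin n × Bool)).filter fun Ψ =>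
              (∀ i j, (Ψ i j).1 = (Φ i j).1) ∧ ∀ i ∉ U Φ, Ψ i = Φ i).image (A n m)).card ≤ N n)
    (ε : ℝ) (hε : 0 < ε) :
    ∀ᶠ n : ℕ in atTop, ∀ m : ℕ, m = ⌊α * n⌋₊ →
      (((univ : Finset (Fin m → Fin k → Fin n × Bool)).filter fun Φ =>
          ∀ i, ∃ j, A n m Φ (Φ i j).1 = (Φ i j).2).card : ℝ)
        / Fintype.card (Fin m → Fin k → Fin n × Bool) ≤ ε := by
  filter_upwards [hA, hN.eventually (ge_mem_nhds hε)] with n hn hsmall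
  intro m hm
  obtain ⟨U, hsU, hU, hNU⟩ := hn m hm
  have h := shwU_card_solved_le (A n m) U (s n) (N n) hU hNU hsU
  rcases (Nat.cast_nonneg (α := ℝ) (Fintype.card (Fin m → Fin k → Fin n × Bool))).eq_or_lt
    with h0 | hpos
  · rw [← h0, div_zero]; exact hε.le
  · rw [div_le_iff₀ hpos]
    exact h.trans (mul_le_mul_of_nonneg_right hsmall (Nat.cast_nonneg _))

/-- **Unread-or-forgotten polarity rung for the crux's hardness conjunct (verbatim shape).** For ANY
`f : List Bool → List Bool`: if, eventually in `n`, the decoded assignment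
`v ↦ (f ⌜Φ⌝).getD v false` on `F_k(n, ⌊αn⌋)` admits self-consistent unread-polarity sets `U Φ`,
`|U Φ| ≥ s n`, on whose sign cylinders it takes at most `N n` values, and
`N n · (1 - 2^{-k})^{s n} → 0`, then `f` satisfies the hardness conjunct of `SearchHardWindow` at
`(k, α)` — no complexity hypothesis, every `k`, every `α`. -/
theorem shwU_hardnessConjunct_of_unreadPolarities (k : ℕ) (α : ℝ) (f : List Bool → List Bool)
    (s N : ℕ → ℕ)
    (hN : Tendsto (fun n : ℕ => (N n : ℝ) * (1 - (1 / 2 : ℝ) ^ k) ^ s n) atTop (nhds 0))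
    (hf : ∀ᶠ n : ℕ in atTop, ∀ m : ℕ, m = ⌊α * n⌋₊ →
      ∃ U : (Fin m → Fin k → Fin n × Bool) → Finset (Fin m),
        (∀ Φ, s n ≤ (U Φ).card) ∧
        (∀ Φ Ψ : Fin m → Fin k → Fin n × Bool,
          (∀ i j, (Ψ i j).1 = (Φ i j).1) → (∀ i ∉ U Φ, Ψ i = Φ i) → U Ψ = U Φ) ∧
        ∀ Φ : Fin m → Fin k → Fin n × Bool,
          (((univ : Finset (Fin m → Fin k → Fin n × Bool)).filter fun Ψ =>
              (∀ i j, (Ψ i j).1 = (Φ i j).1) ∧ ∀ i ∉ U Φ, Ψ i = Φ i).image fun Ψ (v : Fin n) =>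
                (f (encodingCNF.encode (List.ofFn fun a => List.ofFn fun b =>
                  (((Ψ a b).1 : ℕ), (Ψ a b).2)))).getD v false).card ≤ N n) :
    ∀ ε : ℝ, 0 < ε → ∀ᶠ n : ℕ in Filter.atTop, ∀ m : ℕ, m = ⌊α * n⌋₊ →
      ((Finset.univ.filter fun Φ : Fin m → Fin k → Fin n × Bool => ∀ i, ∃ j,
          (f (Literature.Computability.Complexity.encodingCNF.encode (List.ofFn fun a =>
            List.ofFn fun b => (((Φ a b).1 : ℕ), (Φ a b).2)))).getD (Φ i j).1 false =
              (Φ i j).2).card : ℝ) / Fintype.card (Fin m → Fin k → Fin n × Bool) ≤ ε := by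
  intro ε hε
  exact shwU_ratio_eventually_le k α s N hN
    (fun n m Φ v => (f (encodingCNF.encode (List.ofFn fun a => List.ofFn fun b =>
      (((Φ a b).1 : ℕ), (Φ a b).2)))).getD v false) hf ε hε

end Asymptotic

end Summit.PneNP.PneNP.Theorems
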